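import Summits.BirchSwinnertonDyer.BirchSwinnertonDyer.Theorems.PlecticLegsKatoDescentOfFact
import HarnessLib

/-!
# BirchSwinnertonDyer / PlecticLegs — support item `KatoDescent` (stmt-BirchSwinnertonDyer-18262):
# level raising `ℚ(ζ_m) ⊂ ℚ(ζ_{2m})`, one Kato debt instead of two

`PlecticLegsKatoDescentOfFact` closes the route item `KatoDescent` modulo modularity
(`exists_isNewformOf`) and the all-moduli form
`Literature.NumberTheory.EllipticCurves.kato_finite_chiPart_cyclotomic_of_twistedLValue_ne_zero`
of Kato's Cor. 14.3 (2), introduced there because the tree's vendored form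
`kato_finite_chiPart_of_twistedLValue_ne_zero` only speaks of `K = ℚ(ζ_m)` with `m ≢ 2 (mod 4)`.
This file proves that the vendored form already implies the all-moduli form, so that the item
rests on the ORIGINAL named fact alone (plus modularity):

* `KatoDescent.map_mem_chiPart`, `KatoDescent.finite_chiPart_of_injective` — functoriality of
  Kato's `χ`-part: an injective map `ι : M → M'` equivariant along `r : G' → G` carries `M^(χ)`
  into `M'^(χ ∘ r)` (pure algebra);
* `KatoDescent.nonempty_algHom_cyclotomicField` (`m ∣ M ⇒ ℚ(ζ_m) →ₐ ℚ(ζ_M)`),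
  `KatoDescent.exists_restrict_gal` (restriction of `Gal(ℚ(ζ_M)/ℚ)` along it),
  `KatoDescent.cyclotomicCharacterOf_changeLevel` (the cyclotomic character of the induced
  Dirichlet character is the inflation);
* `KatoDescent.changeLevel_two_mul_apply` — for EVEN `m` the character mod `2m` induced by `χ`
  takes the same values on `ℕ` as `χ` (`gcd(n, 2m) = 1 ⇔ gcd(n, m) = 1`), so the mod-`2m` twisted
  series of the induced character IS the mod-`m` series of `χ` — no Euler factor moves;
* `KatoDescent.finite_chiPart_of_kato_fact_all` — hence, for `m ≡ 2 (mod 4)`, Kato's vendored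
  statement at level `2m ≡ 0 (mod 4)` and the injection `E(ℚ(ζ_m))^(χ) ↪ E(ℚ(ζ_{2m}))^(χ̃)`
  give the finiteness at level `m`;
* `kato_finite_chiPart_cyclotomic_of_kato_fact` — **the vendored fact implies the all-moduli
  fact** (with `kato_finite_chiPart_of_cyclotomic` of `PlecticLegsKatoDescentOfFact` the two
  named facts are equivalent);
* `plecticLegs_katoDescent_of_kato_fact` — **`exists_isNewformOf →
  kato_finite_chiPart_of_twistedLValue_ne_zero → KatoDescent`**.

References: K. Kato, Astérisque 295 (2004), Cor. 14.3 (2), p. 235 (the remark that `K ⊂ ℚ(ζ_m)`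
may be enlarged is the module docstring of `KatoTwistedFiniteness`); the Galois side is folklore.
-/

set_option linter.dupNamespace false

noncomputable section

open scoped BigOperators Classical
open Polynomial Literature.NumberTheory.EllipticCurves Module WeierstrassCurve
  WeierstrassCurve.Affine
open Summit.BirchSwinnertonDyer.BirchSwinnertonDyer.Theses.PlecticLegs

namespace Summit.BirchSwinnertonDyer.BirchSwinnertonDyer.Theorems

namespace KatoDescent

/-! ### Functoriality of Kato's `χ`-part -/

/-- **Functoriality of the `χ`-part.** Let `G` act on `M` through `ρ` and `G'` on `M'` through
`ρ'`, let `r : G' → G` and let `ι : M →+ M'` be equivariant along `r`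
(`ρ' τ ∘ ι = ι ∘ ρ (r τ)`). If `χ' = χ ∘ r` then `ι` maps `M^(χ)` into `M'^(χ')`: for
`b = ∑ n_τ τ ∈ I_{χ'}` the push-forward `a = ∑ n_τ r(τ)` lies in `I_χ`, and
`b · ι(x) = ι(a · x) = 0`. [folklore] -/
theorem map_mem_chiPart {G G' M M' R : Type*} [AddCommGroup M] [AddCommGroup M'] [CommRing R]
    {ρ : G → M →+ M} {ρ' : G' → M' →+ M'} {χ : G → R} {χ' : G' → R}
    (ι : M →+ M') (r : G' → G) (hρ : ∀ τ x, ρ' τ (ι x) = ι (ρ (r τ) x))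
    (hχ : ∀ τ, χ' τ = χ (r τ)) {x : M} (hx : x ∈ chiPart ρ χ) : ι x ∈ chiPart ρ' χ' := by
  intro b hb
  have hb' : ((b.mapDomain r).sum fun g n => (n : R) * χ g) = 0 := by
    rw [Finsupp.sum_mapDomain_index (fun _ => by simp) (fun _ _ _ => by push_cast; ring)]
    simpa only [hχ] using hb
  have key := hx (b.mapDomain r) hb'
  rw [Finsupp.sum_mapDomain_index (fun _ => by simp) (fun _ _ _ => add_smul _ _ _)] at key
  calc (b.sum fun τ n => n • ρ' τ (ι x)) = b.sum fun τ n => ι (n • ρ (r τ) x) := by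
        simp only [hρ, map_zsmul]
    _ = ι (b.sum fun τ n => n • ρ (r τ) x) := (map_finsuppSum ι b _).symm
    _ = 0 := by rw [key, map_zero]

/-- An injective map equivariant along `r : G' → G` embeds `M^(χ)` into `M'^(χ ∘ r)`; in
particular `M^(χ)` is finite when `M'^(χ ∘ r)` is. [folklore] -/
theorem finite_chiPart_of_injective {G G' M M' R : Type*} [AddCommGroup M] [AddCommGroup M']
    [CommRing R] {ρ : G → M →+ M} {ρ' : G' → M' →+ M'} {χ : G → R} {χ' : G' → R}
    (ι : M →+ M') (hι : Function.Injective ι) (r : G' → G)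
    (hρ : ∀ τ x, ρ' τ (ι x) = ι (ρ (r τ) x)) (hχ : ∀ τ, χ' τ = χ (r τ))
    (hfin : Finite (chiPart ρ' χ')) : Finite (chiPart ρ χ) :=
  Finite.of_injective
    (fun x : chiPart ρ χ => (⟨ι x, map_mem_chiPart ι r hρ hχ x.2⟩ : chiPart ρ' χ'))
    fun _ _ hxy => Subtype.ext (hι (congrArg Subtype.val hxy))

/-! ### `ℚ(ζ_m) ⊂ ℚ(ζ_M)` for `m ∣ M` and restriction of Galois automorphisms -/

set_option backward.isDefEq.respectTransparency false in
/-- For `m ∣ M` there is a `ℚ`-embedding `ℚ(ζ_m) →ₐ[ℚ] ℚ(ζ_M)` (`ℚ(ζ_m)` is a splitting field of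
the `m`-th cyclotomic polynomial, which splits in `ℚ(ζ_M)`). [folklore] -/
theorem nonempty_algHom_cyclotomicField {m M : ℕ} [NeZero m] [NeZero M] (h : m ∣ M) :
    Nonempty (CyclotomicField m ℚ →ₐ[ℚ] CyclotomicField M ℚ) := by
  haveI := IsCyclotomicExtension.of_union_of_dvd ℚ (CyclotomicField M ℚ) (S := {M}) (n := m)
    ⟨M, Set.mem_singleton M, NeZero.ne M, h⟩
  have hsplit : Splits ((cyclotomic m ℚ).map (algebraMap ℚ (CyclotomicField M ℚ))) :=
    IsCyclotomicExtension.splits_cyclotomic ℚ (CyclotomicField M ℚ) (S := {M} ∪ {m}) (by simp)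
  haveI : IsSplittingField ℚ (CyclotomicField m ℚ) (cyclotomic m ℚ) :=
    IsCyclotomicExtension.splitting_field_cyclotomic m ℚ (CyclotomicField m ℚ)
  exact ⟨IsSplittingField.lift (CyclotomicField m ℚ) (cyclotomic m ℚ) hsplit⟩

set_option backward.isDefEq.respectTransparency false in
/-- Restriction of automorphisms of `ℚ(ζ_M)` to a subfield `ℚ(ζ_m)` (normal over `ℚ`) along an
embedding `ι`: every `τ ∈ Gal(ℚ(ζ_M)/ℚ)` has a `σ ∈ Gal(ℚ(ζ_m)/ℚ)` with `ι ∘ σ = τ ∘ ι`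
(Mathlib `AlgEquiv.restrictNormal`). [folklore] -/
theorem exists_restrict_gal {m M : ℕ} [NeZero m] [NeZero M]
    (ι : CyclotomicField m ℚ →ₐ[ℚ] CyclotomicField M ℚ)
    (τ : CyclotomicField M ℚ ≃ₐ[ℚ] CyclotomicField M ℚ) :
    ∃ σ : CyclotomicField m ℚ ≃ₐ[ℚ] CyclotomicField m ℚ, ∀ z, ι (σ z) = τ (ι z) := by
  letI : Algebra (CyclotomicField m ℚ) (CyclotomicField M ℚ) := ι.toRingHom.toAlgebra
  haveI : IsScalarTower ℚ (CyclotomicField m ℚ) (CyclotomicField M ℚ) :=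
    IsScalarTower.of_algebraMap_eq fun q => (ι.commutes q).symm
  haveI : IsGalois ℚ (CyclotomicField m ℚ) := isGalois_cyclotomicField m
  exact ⟨τ.restrictNormal (CyclotomicField m ℚ),
    fun z => τ.restrictNormal_commutes (CyclotomicField m ℚ) z⟩

/-! ### Cyclotomic exponents -/

set_option backward.isDefEq.respectTransparency false in
/-- An automorphism `τ` of `ℚ(ζ_M)` raises EVERY `M`-th root of unity to the power
`a = autEquivPow τ` (`τ ζ = ζ^a` for the distinguished primitive root, and every `M`-th root of
unity is a power of it). [folklore] -/
theorem apply_eq_pow_autEquivPow {M : ℕ} [NeZero M]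
    (τ : CyclotomicField M ℚ ≃ₐ[ℚ] CyclotomicField M ℚ) (w : CyclotomicField M ℚ)
    (hw : w ^ M = 1) :
    τ w = w ^ ((IsCyclotomicExtension.autEquivPow (CyclotomicField M ℚ)
      (cyclotomic.irreducible_rat (NeZero.pos M)) τ : (ZMod M)ˣ) : ZMod M).val := by
  set ζ := IsCyclotomicExtension.zeta M ℚ (CyclotomicField M ℚ) with hζdef
  have hζ : IsPrimitiveRoot ζ M := IsCyclotomicExtension.zeta_spec M ℚ (CyclotomicField M ℚ)
  have hspec : ζ ^ ((IsCyclotomicExtension.autEquivPow (CyclotomicField M ℚ)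
      (cyclotomic.irreducible_rat (NeZero.pos M)) τ : (ZMod M)ˣ) : ZMod M).val = τ ζ :=
    hζ.autToPow_spec ℚ τ
  obtain ⟨i, -, rfl⟩ := hζ.eq_pow_of_pow_eq_one hw
  rw [map_pow, ← hspec, ← pow_mul, ← pow_mul, mul_comm]

set_option backward.isDefEq.respectTransparency false in
/-- If `σ ∈ Gal(ℚ(ζ_m)/ℚ)` raises the `m`-th roots of unity to the `a`-th power then
`a ≡ autEquivPow σ (mod m)`. [folklore] -/
theorem natCast_eq_autEquivPow {m : ℕ} [NeZero m]
    (σ : CyclotomicField m ℚ ≃ₐ[ℚ] CyclotomicField m ℚ) (a : ℕ)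
    (ha : ∀ z : CyclotomicField m ℚ, z ^ m = 1 → σ z = z ^ a) :
    (a : ZMod m) = ((IsCyclotomicExtension.autEquivPow (CyclotomicField m ℚ)
      (cyclotomic.irreducible_rat (NeZero.pos m)) σ : (ZMod m)ˣ) : ZMod m) := by
  set e := IsCyclotomicExtension.autEquivPow (CyclotomicField m ℚ)
    (cyclotomic.irreducible_rat (NeZero.pos m)) with he
  set ζ := IsCyclotomicExtension.zeta m ℚ (CyclotomicField m ℚ) with hζdef
  have hζ : IsPrimitiveRoot ζ m := IsCyclotomicExtension.zeta_spec m ℚ (CyclotomicField m ℚ)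
  have hspec : ζ ^ ((e σ : (ZMod m)ˣ) : ZMod m).val = σ ζ := hζ.autToPow_spec ℚ σ
  have hred : ∀ k : ℕ, ζ ^ k = ζ ^ (k % m) := fun k => by
    conv_lhs => rw [← Nat.div_add_mod k m, pow_add, pow_mul, hζ.pow_eq_one, one_pow, one_mul]
  have hmod : ((e σ : (ZMod m)ˣ) : ZMod m).val % m = a % m := by
    refine hζ.pow_inj (Nat.mod_lt _ (NeZero.pos m)) (Nat.mod_lt _ (NeZero.pos m)) ?_
    rw [← hred, ← hred, hspec, ha ζ hζ.pow_eq_one]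
  rw [← ZMod.natCast_zmod_val ((e σ : (ZMod m)ˣ) : ZMod m), ZMod.natCast_eq_natCast_iff']
  exact hmod.symm

/-- `cyclotomicCharacterOf χ σ = χ(a)` whenever `σ` raises the `m`-th roots of unity to the
`a`-th power (the route's spelling of "`σ ↦ a`"). [folklore] -/
theorem cyclotomicCharacterOf_apply_of_forall_pow {m : ℕ} [NeZero m] (χ : DirichletCharacter ℂ m)
    (σ : CyclotomicField m ℚ ≃ₐ[ℚ] CyclotomicField m ℚ) (a : ℕ)
    (ha : ∀ z : CyclotomicField m ℚ, z ^ m = 1 → σ z = z ^ a) :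
    (cyclotomicCharacterOf χ σ : ℂ) = χ (a : ZMod m) := by
  rw [coe_cyclotomicCharacterOf_apply, ← natCast_eq_autEquivPow σ a ha]

set_option backward.isDefEq.respectTransparency false in
/-- **Inflation.** For `m ∣ M`, `ι : ℚ(ζ_m) →ₐ ℚ(ζ_M)`, `τ ∈ Gal(ℚ(ζ_M)/ℚ)` restricting to
`σ ∈ Gal(ℚ(ζ_m)/ℚ)` (`ι ∘ σ = τ ∘ ι`) and a Dirichlet character `χ` mod `m` with induced
character `χ̃ = changeLevel χ` mod `M`: `cyclotomicCharacterOf χ̃ τ = cyclotomicCharacterOf χ σ`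
(if `τ` acts on `μ_M` by `a` then `σ` acts on `μ_m` by `a`, and `χ̃(a) = χ(a mod m)`). [folklore] -/
theorem cyclotomicCharacterOf_changeLevel {m M : ℕ} [NeZero m] [NeZero M] (h : m ∣ M)
    (χ : DirichletCharacter ℂ m) (ι : CyclotomicField m ℚ →ₐ[ℚ] CyclotomicField M ℚ)
    (σ : CyclotomicField m ℚ ≃ₐ[ℚ] CyclotomicField m ℚ)
    (τ : CyclotomicField M ℚ ≃ₐ[ℚ] CyclotomicField M ℚ) (hστ : ∀ z, ι (σ z) = τ (ι z)) :
    (cyclotomicCharacterOf (DirichletCharacter.changeLevel h χ) τ : ℂ) =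
      cyclotomicCharacterOf χ σ := by
  have hσ : ∀ z : CyclotomicField m ℚ, z ^ m = 1 → σ z =
      z ^ ((IsCyclotomicExtension.autEquivPow (CyclotomicField M ℚ)
        (cyclotomic.irreducible_rat (NeZero.pos M)) τ : (ZMod M)ˣ) : ZMod M).val := fun z hz => by
    apply ι.toRingHom.injective
    change ι (σ z) = ι (z ^ _)
    rw [hστ, map_pow]
    refine apply_eq_pow_autEquivPow τ (ι z) ?_
    obtain ⟨d, rfl⟩ := h
    rw [← map_pow, pow_mul, hz, one_pow, map_one]
  rw [cyclotomicCharacterOf_apply_of_forall_pow χ σ _ hσ, coe_cyclotomicCharacterOf_apply,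
    DirichletCharacter.changeLevel_eq_cast_of_dvd χ h, ZMod.cast_eq_val]

/-! ### Level `m ↦ 2m` for even `m`: the twisted series does not change -/

/-- For EVEN `m` and a Dirichlet character `χ` mod `m`, the induced character mod `2m` takes the
same value as `χ` at every natural number: both vanish unless `n` is prime to `m`, which for
even `m` is the same as prime to `2m`. [folklore] -/
theorem changeLevel_two_mul_apply {m : ℕ} [NeZero m] (hm : Even m) (χ : DirichletCharacter ℂ m)
    (n : ℕ) :
    DirichletCharacter.changeLevel (dvd_mul_left m 2) χ (n : ZMod (2 * m)) = χ (n : ZMod m) := by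
  by_cases hn : n.Coprime (2 * m)
  · have hu : IsUnit (n : ZMod (2 * m)) := (ZMod.isUnit_iff_coprime n (2 * m)).mpr hn
    obtain ⟨u, hu'⟩ := hu
    rw [← hu', DirichletCharacter.changeLevel_eq_cast_of_dvd χ (dvd_mul_left m 2), hu',
      ZMod.cast_natCast (dvd_mul_left m 2)]
  · have hn' : ¬ n.Coprime m := fun hc => hn (by
      refine Nat.Coprime.mul_right ?_ hc
      obtain ⟨k, rfl⟩ := hm
      exact Nat.Coprime.coprime_dvd_right ⟨k, by ring⟩ hc)
    rw [MulChar.map_nonunit _ (mt (ZMod.isUnit_iff_coprime n (2 * m)).mp hn),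
      MulChar.map_nonunit _ (mt (ZMod.isUnit_iff_coprime n m).mp hn')]

/-! ### Kato's finiteness for every `m` from the vendored fact -/

open Literature.NumberTheory.EllipticCurves.ModularForms in
set_option backward.isDefEq.respectTransparency false in
/-- **Kato's Cor. 14.3 (2) over `ℚ(ζ_m)` for EVERY `m`, from the vendored case `m ≢ 2 (mod 4)`.**
For `m ≡ 2 (mod 4)` apply the vendored fact at level `2m ≡ 0 (mod 4)` to the induced character
`χ̃` (same twisted series, `changeLevel_two_mul_apply`) and pull the finiteness of
`E(ℚ(ζ_{2m}))^(χ̃)` back along the equivariant injection `E(ℚ(ζ_m)) ↪ E(ℚ(ζ_{2m}))`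
(`finite_chiPart_of_injective`, `cyclotomicCharacterOf_changeLevel`).
[cite: Kato2004Asterisque, Cor. 14.3 (2) (p. 235)] -/
theorem finite_chiPart_of_kato_fact_all (hK : kato_finite_chiPart_of_twistedLValue_ne_zero)
    (W : WeierstrassCurve ℚ) [W.IsElliptic] {N : ℕ} [NeZero N]
    {f : CuspForm (CongruenceSubgroup.Gamma0 N) 2} (hf : IsNewformOf W f) (m : ℕ) [NeZero m]
    (χ : DirichletCharacter ℂ m)
    (hL : ∃ L : ℂ → ℂ, Differentiable ℂ L ∧
      (∀ s : ℂ, 2 < s.re → L s = twistedLSeries f χ s) ∧ L 1 ≠ 0) :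
    Finite (chiPart
      (fun σ : CyclotomicField m ℚ ≃ₐ[ℚ] CyclotomicField m ℚ =>
        Point.map (W' := W.toAffine) (σ : CyclotomicField m ℚ →ₐ[ℚ] CyclotomicField m ℚ))
      (fun σ => (cyclotomicCharacterOf χ σ : ℂ))) := by
  by_cases hm : m % 4 = 2
  · -- level raising `m ↦ 2m`
    haveI : NeZero (2 * m) := ⟨mul_ne_zero two_ne_zero (NeZero.ne m)⟩
    have h4 : (2 * m) % 4 ≠ 2 := by omega
    have heven : Even m := ⟨m / 2, by omega⟩
    set χ' := DirichletCharacter.changeLevel (dvd_mul_left m 2) χ with hχ'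
    have hL' : ∃ L : ℂ → ℂ, Differentiable ℂ L ∧
        (∀ s : ℂ, 2 < s.re → L s = twistedLSeries f χ' s) ∧ L 1 ≠ 0 := by
      obtain ⟨L, hLd, hLs, hL1⟩ := hL
      refine ⟨L, hLd, fun s hs => ?_, hL1⟩
      rw [hLs s hs, twistedLSeries, twistedLSeries]
      congr 1
      funext n
      rw [hχ', changeLevel_two_mul_apply heven χ n]
    have hfin := hK W hf h4 χ' hL'
    obtain ⟨ι⟩ := nonempty_algHom_cyclotomicField (dvd_mul_left m 2)
    choose r hr using exists_restrict_gal ι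
    refine finite_chiPart_of_injective (Point.map (W' := W.toAffine) ι)
      (Point.map_injective (W' := W.toAffine) ι) r (fun τ x => ?_)
      (fun τ => cyclotomicCharacterOf_changeLevel (dvd_mul_left m 2) χ ι (r τ) τ (hr τ)) hfin
    have hcomp : (τ : CyclotomicField (2 * m) ℚ →ₐ[ℚ] CyclotomicField (2 * m) ℚ).comp ι =
        ι.comp (r τ : CyclotomicField m ℚ →ₐ[ℚ] CyclotomicField m ℚ) :=
      AlgHom.ext fun z => (hr τ z).symm
    rw [Point.map_map, Point.map_map, hcomp]
  · exact hK W hf hm χ hL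

end KatoDescent

/-- **The vendored Kato fact implies its all-moduli form**: Kato, Astérisque 295, Cor. 14.3 (2)
for `K = ℚ(ζ_m)` with `m ≢ 2 (mod 4)` (`kato_finite_chiPart_of_twistedLValue_ne_zero`) gives the
same statement for every `m ≥ 1` (`kato_finite_chiPart_cyclotomic_of_twistedLValue_ne_zero`) by
level raising `ℚ(ζ_m) ⊂ ℚ(ζ_{2m})` (`KatoDescent.finite_chiPart_of_kato_fact_all`); together with
`kato_finite_chiPart_of_cyclotomic` the two named facts are equivalent. The decidability instance
quantified in the all-moduli statement is identified with the classical one (all such instances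
are equal). [cite: Kato2004Asterisque, Cor. 14.3 (2) (p. 235)] -/
theorem kato_finite_chiPart_cyclotomic_of_kato_fact
    (hK : Literature.NumberTheory.EllipticCurves.kato_finite_chiPart_of_twistedLValue_ne_zero) :
    Literature.NumberTheory.EllipticCurves.kato_finite_chiPart_cyclotomic_of_twistedLValue_ne_zero := by
  intro W _ N _ f hf m _ inst χ hL
  have hinst : inst = fun a b => Classical.propDecidable (a = b) := Subsingleton.elim _ _
  subst hinst
  exact KatoDescent.finite_chiPart_of_kato_fact_all hK W hf m χ hL

/-- **The item `KatoDescent` modulo the ORIGINAL named facts**: modularity (`exists_isNewformOf`,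
BCDT 2001 Thm. A) and Kato's Cor. 14.3 (2) exactly as vendored in the tree
(`kato_finite_chiPart_of_twistedLValue_ne_zero`, `K = ℚ(ζ_m)`, `m ≢ 2 (mod 4)`) imply the route
item, via `kato_finite_chiPart_cyclotomic_of_kato_fact` and `plecticLegs_katoDescent_of_kato`.
[cite: Kato2004Asterisque, Cor. 14.3 (2) (p. 235)] -/
theorem plecticLegs_katoDescent_of_kato_fact
    (hmod : Literature.NumberTheory.EllipticCurves.ModularForms.exists_isNewformOf)
    (hK : Literature.NumberTheory.EllipticCurves.kato_finite_chiPart_of_twistedLValue_ne_zero) :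
    KatoDescent :=
  plecticLegs_katoDescent_of_kato hmod (kato_finite_chiPart_cyclotomic_of_kato_fact hK)

end Summit.BirchSwinnertonDyer.BirchSwinnertonDyer.Theorems

end
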